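/-
Copyright: lit-balaban Phase-2 proof seat p31 (gen 3).  Statement-level skeleton of a published paper; no proof claims beyond what the
kernel checks below.
-/
import Literature.MathematicalPhysics.QuantumFieldTheory.BalabanImbrieJaffe1984to88.BIJ85Eq224ProofPart2
import Literature.MathematicalPhysics.QuantumFieldTheory.BalabanImbrieJaffe1984to88.BIJ85SmallFieldSplit64

/-!
# `BalabanImbrieJaffe1984to88.BIJ85Eq454Holonomy` — T. Bałaban, J. Imbrie, A. Jaffe, *Renormalization of the Higgs model: minimizers,
propagators and the stability of mean field theory*, Commun. Math. Phys. **97** (1985) 299–329 [BalabanImbrieJaffe1985]: the PLAQUETTE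
VARIABLES of the group-valued pull-back `Q^{s*}_k v` (4.5.2)–(4.5.3) and of the background field `u_k` (4.5.4) ON THE TORI — the
holonomy sentence of Remark 2 p. 317 and the second summand of (6.4) p. 318, PROVED

statement-level skeleton of published theorems with citation tags; proofs where landed; nothing here is a claim about the Yang–Mills mass gap

PDF held: `paper:balaban1985-cmp97-bij-higgs-minimizers` (journal page = PDF page + 298).  Pages read as images:
`run/shared/lean/pub/lit-balaban/lit-balaban-r15/pages/1985-cmp97-bij-higgs-minimizers-p014-x2.png` (p. 312), `…-p015-x2.png` (p. 313),
`…-p019-x2.png` (p. 317), `…-p020-x2.png` (p. 318).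

CITATION HEADER (lean-in-tree rule).  Part of the lit-balaban TYPED SKELETON (HOME `run/shared/lean/pub/lit-balaban/`), Phase-2 seat p31
(gen 3); rows **C1.Eq4.5.4** ((4.5.4), typed as `BIJ85Sect2SurfaceAverages.BlockBonds.backgroundField`), **C1.Rem@317** (Remark 2, whose
operator algebra is `BIJ85Eq427Proof.eq5212`/`eq5211` with the holonomy field `hol` a hypothesis `hhol`) and **C1.Eq6.1-6.4** ((6.4), typed in
`BIJ85SmallFieldSplit64` with the identification of the second summand reserved, its note T1) of `HOME/SKELETON.md` / `HOME/lit-balaban-r15/ROWS-C1.md`.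

THE PRINTED TEXT (verbatim).  p. 312 [PDF 14]: *"We can represent an arbitrary v as v_b = exp(ie_kB_b), (4.5.1) where B_b = (ie_k)^{−1} ln v_b,
and the branch of the logarithm was chosen in (2.11). Then we extend the definition Q^*_s from the Lie algebra to group variables v by the
definition (Q^{s*}_kv)_b = exp((ie_kηQ^{s*}_kB)_b), b ∈ T_η. (4.5.2) This raises the question of what happens if we choose another branch of
the logarithm. The independence of the resulting transformation on this choice follows from the equivalent definition: (Q^{s*}_kv)_b = 1 if
b is strictly contained in a k-block (both endpoints belong to the block), v_c if the η-lattice bond b belongs to the corridor of bonds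
connecting the two blocks B^k(c₋) and B^k(c₊). Here c is a unit lattice bond. (4.5.3)"*; p. 313 [PDF 15]: *"Now we define (u_k)_b =
(Q^{s*}_kv)_b exp[−ie_kη(𝒟_k∂^*Q^{e*}_kf^{(k)})_b]. (4.5.4)"*; p. 317 [PDF 19]: *"Remark 2. The gauge field quadratic form ⟨f^{(k)},σ_kf^{(k)}⟩
can now be written entirely as a function of the η-lattice gauge field u_k. In fact ⟨f^{(k)},σ_kf^{(k)}⟩ = Σ_{p∈T_η} η^d|f_k(p)|², (5.2.11)
where f_k(p) = (ie_kη²)^{−1} ln u_k(∂p). (5.2.12) This follows from the definition (4.5.4) of u_k, giving u_k(∂p) = exp[ie_kη²Q^{e*}_kf^{(k)} −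
ie_kη²∂𝒟_k∂^*Q^{e*}_kf^{(k)}]. From this and (5.2.10) we get (ie_kη²)^{−1} ln u_k(∂p) = Q^{e*}_kf^{(k)} − ∂G_{k,Ax}∂^*Q^{e*}_kf^{(k)}, coinciding
with (4.2.6)."*; p. 318 [PDF 20]: *"Let v denote the average gauge field on the L-lattice, and on the unit lattice let u = u′Q^{s*}v, u′ =
exp(ie_kB′). (6.2) The plaquette field f^{(k)}(p) = (ie_k)^{−1} ln u(∂p), p ∈ T₁, (6.3) then decomposes as f^{(k)}(p) = (ie_k)^{−1} ln u′(∂p) +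
(ie_k)^{−1} ln(Q^{s*}v)(∂p) = (∂B′)(p) + L^{−d/2}(Q^{e*}f^{(k+1)})(p), (6.4) which is valid as long as u′(p) and (Q^{s*}_kv)(p) are close to 1.
The new field f^{(k+1)} is an L-lattice field, but Q^{e*}_k maps it back (to edge plaquettes) in the unit lattice."*; (4.2.4) p. 310:
*"f^{(k)} = (ie_k)^{−1} ln v(∂p), p ∈ T₁^{(k)}, where e_k = e(L^kε)^{(4−d)/2}"*; (2.22) p. 305: *"(Q^{e*}f)(p) = L²f(p′), if p ∈ B^e(p′), 0,
otherwise"*.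

WHAT IS REPRODUCED, and how.  The carriers are the tree's: the k-fold two-scale geometries of the tori `BIJ85Eq224Proof.torusBlockBondsIter P i k`
(fine lattice `T^{(i)}` = the η-lattice, coarse lattice `T^{(i+k)}` = the unit lattice, block size `L^k`; `Q^{s*}_k` = its `BlockBonds.Qsstar`, factor
`L^k` as in (2.17)) and `BIJ85Eq224ProofPart2.torusEdgeCellsIter P i k hd` (`Q^{e*}_k` = its `Cells.Qstar`, factor `L^{2k}` as in (2.22)), the
one-step geometries `BIJ85Eq219Proof.torusBlockBonds` / `BIJ85CurlQsstar.torusEdgeCells`; U(1) bond fields, plaquette variables `u(∂p)`, the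
Lie-algebra exponential `u = exp(ieB)` and the plaquette field `(ie)^{−1} ln u(∂p)` with the branch (2.11) are `BIJ85Sect1Model.U1Field` / `plaq` /
`BIJ85SmallFieldSplit64.expField` / `plaqField`; rescaling is the identity on these types (the cell's convention, `Balaban1983to89.Setup` F7), so
the "L-lattice field f^{(k+1)}" of (6.4) lives on `Plaq P (j+1)` and the unit/η bookkeeping is carried by the real parameters `e`, `η`.
* §1 dictionary: the group-valued pull-back (4.5.2) `Q^{s*}_kv`, `v = exp(ie_kB)`, IS the U(1) field `expField (e_kη) (Q^{s*}_kB)` — its values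
  are `BlockBonds.QsstarGroup` (`coe_expField_Qsstar`) — and the background field (4.5.4) IS `expField (e_kη) (Q^{s*}_kB − X)`, values
  `BlockBonds.backgroundField` (`coe_expField_background`; `X` = the real η-lattice bond field 𝒟_k∂^*Q^{e*}_kf^{(k)}, supplied exactly as in the
  typed definition (4.5.4)).
* §2 THE GROUP-VALUED CURL IDENTITY (the multiplicative form of *"∂Q^{s*}_kB = Q^{e*}_k∂B"*, p. 317): on the tori, with `ηL^k = 1`,
  **`(Q^{s*}_kv)(∂p) = v(∂p′)` if `p ∈ B^e_k(p′)` and `= 1` otherwise** (`plaq_QsstarU1_of_mem`, `plaq_QsstarU1_of_not_mem`; from the additive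
  identity `BIJ85Eq224ProofPart2.curl_QsstarIter` and `plaq (expField a A) = exp(ia·A(∂p))`), i.e. `(Q^{s*}_kv)(∂p) = exp[ie_kη²(Q^{e*}_kf^{(k)})(p)]`
  with `f^{(k)} = (ie_k)^{−1} ln v(∂·)` (`plaq_QsstarU1_eq_exp`) — independent of the branch, as p. 312 says; one-step versions `plaq_Qsstar1U1_*`.
* §3 **the holonomy sentence of Remark 2** p. 317 for (4.5.4): `u_k(∂p) = exp[ie_kη²((Q^{e*}_kf^{(k)})(p) − (∂X)(p))]`, `∂ = curl η⁻¹` the η-lattice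
  curl (`plaq_background_eq_exp`), and its Lie-algebra form **(5.2.12)** `(ie_kη²)^{−1} ln u_k(∂p) = (Q^{e*}_kf^{(k)})(p) − (∂X)(p)` whenever the
  right side times `e_kη²` lies in the range `(−π, π)` of the branch (2.11) (`plaqField_background`) — this is the field `hol` with the hypothesis
  `hhol` of `BIJ85Eq427Proof.eq5212` in the torus model (there `X = 𝒟_k∂^*Q^{e*}_kf^{(k)}` and (5.2.10) turns `∂𝒟_k∂^*` into `∂G_{k,Ax}∂^*`).
* §4 **(6.4), second summand** p. 318, one step (`T^{(j)}` unit lattice, `T^{(j+1)}` the L-lattice, `ηL = 1`): `(ie_k)^{−1} ln(Q^{s*}v)(∂p) =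
  L^{−d/2}(Q^{e*}f^{(k+1)})(p)` EXACTLY (no smallness needed for this summand), with `f^{(k+1)} = (ie_{k+1})^{−1} ln v(∂·)` and `e_{k+1} =
  L^{(4−d)/2}e_k` ((4.2.4): `eEps_mul`) (`eq64_second_summand`; general-coupling form `plaqField_Qsstar1U1`), and hence **(6.4)** itself in the
  small-field region of `BIJ85SmallFieldSplit64.eq64_smallField` (`eq64`).
The named-coarse-level (`BIJ85Eq224Base0.torusBlockBondsTo`) and base-0 composite (`BIJ85Eq531Inputs.QsstarIter`) forms are the sibling
`BIJ85Eq454HolonomyBase0`.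
Standing range `i + k ≤ m + K` (`hk`) / `j + 1 ≤ m + K` (`hj`); `2 ≤ d` (`hd`) for the edge-plaquette carrier; `e ≠ 0` where a logarithm is divided
by `e`.  NOTHING of the paper beyond the kernel-checked identities below is asserted; in particular 𝒟_k, G_{k,Ax}, σ_k and (5.2.10)–(5.2.11) are
not touched here (see `BIJ85Eq427Proof`, `BIJ85Sigma421Torus`).  Unit `lit-balaban-p31` (literature-prover-lit-balaban-p31-g3-0), 2026-08-21.
-/

open scoped BigOperators Real

namespace Literature.MathematicalPhysics.QuantumFieldTheory.BalabanImbrieJaffe1984to88.BIJ85Eq454Holonomy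

open Literature.MathematicalPhysics.QuantumFieldTheory.Balaban1983to89
open BIJ85Sect2SurfaceAverages BIJ85CellAverages LatticeFieldCalculus BIJ85Eq219Proof BIJ85CurlQsstar BIJ85Eq224Proof
  BIJ85Eq224ProofPart2 BIJ85Sect1Model BIJ85SmallFieldSplit64

variable {P : Params} {i j : ℕ}

/-! ## 0. Plumbing: the unit plaquette sum, the branch at `1`, the U(1) exponential -/

/-- plumbing: the plaquette sum `curl1` of `BIJ85SmallFieldSplit64` IS the lattice curl `curl 1` of `LatticeFieldCalculus` (same orientation).
[cite: BalabanImbrieJaffe1985, (6.4) p.318] -/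
theorem curl_one_eq_curl1 (B : PBond P j → ℝ) : curl 1 B = curl1 B := by
  funext p
  simp [curl, curl1]

/-- plumbing: the lattice curl is homogeneous in its lattice factor, `(∂_c B)(p) = c·(∂_1 B)(p)`. [cite: BalabanImbrieJaffe1985, (6.4) p.318] -/
theorem curl_eq_mul_curl1 (c : ℝ) (B : PBond P j → ℝ) (p : Plaq P j) : curl c B p = c * curl1 B p := by
  simp [curl, curl1]

/-- plumbing: the branch (2.11) vanishes at `1` (`ln 1 = 0`). [cite: BalabanImbrieJaffe1985, (2.11) p.303] -/
theorem argB_one : argB 1 = 0 := by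
  have h : Complex.arg 1 ≠ π := by rw [Complex.arg_one]; exact Real.pi_ne_zero.symm
  rw [argB_eq_arg h, Complex.arg_one]

/-- plumbing: the plaquette field (6.3) of the trivial plaquette variable is `0`. [cite: BalabanImbrieJaffe1985, (6.3) p.318] -/
theorem plaqField_eq_zero_of_plaq_eq_one (e : ℝ) {u : U1Field P j} {p : Plaq P j} (h : plaq u p = 1) : plaqField e u p = 0 := by
  rw [plaqField, h, Circle.coe_one, argB_one, zero_div]

/-- plumbing: `exp(ie·f(p)) = u(∂p)` for the plaquette field `f = (ie)^{−1} ln u(∂·)` ((6.3)/(4.2.4)), as an identity in U(1) (`e ≠ 0`).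
[cite: BalabanImbrieJaffe1985, (6.3) p.318] -/
theorem circleExp_plaqField (e : ℝ) (he : e ≠ 0) (u : U1Field P j) (p : Plaq P j) :
    Circle.exp (e * plaqField e u p) = plaq u p :=
  Circle.ext (by rw [Circle.coe_exp]; exact exp_plaqField e he u p)

/-- plumbing: the plaquette field of a U(1) plaquette variable written as `exp(ia·t)` with `a·t` inside the range `(−π, π)` of the branch (2.11)
is `t` (`a ≠ 0`). [cite: BalabanImbrieJaffe1985, (2.11) p.303] -/
theorem plaqField_of_plaq_eq_exp {a t : ℝ} (ha : a ≠ 0) {u : U1Field P j} {p : Plaq P j} (h : plaq u p = Circle.exp (a * t))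
    (hsmall : |a * t| < π) : plaqField a u p = t := by
  unfold plaqField
  rw [h, Circle.coe_exp]
  have hmem : a * t ∈ Set.Ico (-π) π := ⟨(abs_lt.mp hsmall).1.le, (abs_lt.mp hsmall).2⟩
  rw [show ((a * t : ℝ) : ℂ) * Complex.I = ((a * t : ℝ)) * Complex.I from rfl, argB_exp_mul_I hmem]
  field_simp

/-! ## 1. Dictionary: (4.5.2) and (4.5.4) as U(1) bond fields on the tori -/

/-- **(4.5.2)** p. 312 [PDF 14] as a U(1) field: the values of `expField (e_kη) (Q^{s*}_kB)` on the η-lattice `T^{(i)}` ARE the typed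
`(Q^{s*}_kv)_b = exp((ie_kηQ^{s*}_kB)_b)` (`BlockBonds.QsstarGroup`) of the k-fold torus geometry. [cite: BalabanImbrieJaffe1985, (4.5.2) p.312] -/
theorem coe_expField_Qsstar (k : ℕ) (e η : ℝ) (B : PBond P (i + k) → ℝ) (b : PBond P i) :
    ((expField (e * η) ((torusBlockBondsIter P i k).Qsstar B) b : Circle) : ℂ) = (torusBlockBondsIter P i k).QsstarGroup e η B b := by
  rw [expField, Circle.coe_exp, BlockBonds.QsstarGroup]
  congr 1
  push_cast
  ring

/-- **(4.5.4)** p. 313 [PDF 15] as a U(1) field: the values of `expField (e_kη) (Q^{s*}_kB − X)` ARE the typed background field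
`(u_k)_b = (Q^{s*}_kv)_b exp[−ie_kηX_b]` (`BlockBonds.backgroundField`, `X` = 𝒟_k∂^*Q^{e*}_kf^{(k)} supplied) of the k-fold torus geometry.
[cite: BalabanImbrieJaffe1985, (4.5.4) p.313] -/
theorem coe_expField_background (k : ℕ) (e η : ℝ) (B : PBond P (i + k) → ℝ) (X : PBond P i → ℝ) (b : PBond P i) :
    ((expField (e * η) (fun b => (torusBlockBondsIter P i k).Qsstar B b - X b) b : Circle) : ℂ) =
      (torusBlockBondsIter P i k).backgroundField e η B X b := by
  rw [BlockBonds.backgroundField_eq_exp, expField, Circle.coe_exp]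
  congr 1
  push_cast
  ring

/-- (4.5.4) is the product (6.2)-style `u_k = (Q^{s*}_kv)·exp(−ie_kηX)` of two U(1) fields (`BIJ85SmallFieldSplit64.translate62`).
[cite: BalabanImbrieJaffe1985, (4.5.4) p.313] -/
theorem expField_background_eq_translate62 (k : ℕ) (e η : ℝ) (B : PBond P (i + k) → ℝ) (X : PBond P i → ℝ) :
    expField (e * η) (fun b => (torusBlockBondsIter P i k).Qsstar B b - X b) =
      translate62 (expField (e * η) ((torusBlockBondsIter P i k).Qsstar B)) (expField (e * η) (fun b => -X b)) := by
  funext b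
  simp only [expField, translate62, ← Circle.exp_add]
  congr 1
  ring

/-! ## 2. The group-valued curl identity: `(Q^{s*}_kv)(∂p) = v(∂p′)` on edge plaquettes, `1` elsewhere -/

/-- kernel: the plaquette variable of `exp(ia·Q^{s*}_kB)` is `exp(ia·(Q^{e*}_k ∂_{L^{−k}}B)(p))` — the additive identity
`BIJ85Eq224ProofPart2.curl_QsstarIter` exponentiated (standing range, `2 ≤ d`). [cite: BalabanImbrieJaffe1985, (4.5.2) p.312] -/
theorem plaq_expField_QsstarIter (hd : 2 ≤ P.d) {k : ℕ} (hk : i + k ≤ P.m + P.K) (a : ℝ) (B : PBond P (i + k) → ℝ) (p : Plaq P i) :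
    plaq (expField a ((torusBlockBondsIter P i k).Qsstar B)) p =
      Circle.exp (a * (torusEdgeCellsIter P i k hd).Qstar (curl ((P.L : ℝ) ^ k)⁻¹ B) p) := by
  have hL : (P.L : ℝ) ^ k ≠ 0 := pow_ne_zero _ (Nat.cast_ne_zero.mpr P.L_pos.ne')
  rw [plaq_expField, ← curl_one_eq_curl1, ← mul_inv_cancel₀ hL, curl_QsstarIter hd k hk ((P.L : ℝ) ^ k)⁻¹ B]

/-- **(4.5.3) ⇒ the plaquette variables of `Q^{s*}_kv`**, first case: for an edge plaquette `p ∈ B^e_k(p′)` of the unit-lattice plaquette `p′`,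
`(Q^{s*}_kv)(∂p) = v(∂p′)` — the four bonds of `p` are corridor bonds of the four bonds of `p′` (p. 312), so the plaquette variable of the
pull-back is the coarse plaquette variable; `v = exp(ie_kB)` ((4.5.1)), `ηL^k = 1` (standing range, `2 ≤ d`).  The multiplicative form of
*"∂Q^{s*}_kB = Q^{e*}_k∂B"* (p. 317). [cite: BalabanImbrieJaffe1985, (4.5.3) p.312] -/
theorem plaq_QsstarU1_of_mem (hd : 2 ≤ P.d) {k : ℕ} (hk : i + k ≤ P.m + P.K) (e η : ℝ) (hη : η * (P.L : ℝ) ^ k = 1)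
    (B : PBond P (i + k) → ℝ) {p : Plaq P i} {p' : Plaq P (i + k)} (h : p ∈ (torusEdgeCellsIter P i k hd).B p') :
    plaq (expField (e * η) ((torusBlockBondsIter P i k).Qsstar B)) p = plaq (expField e B) p' := by
  have hL : (P.L : ℝ) ^ k ≠ 0 := pow_ne_zero _ (Nat.cast_ne_zero.mpr P.L_pos.ne')
  rw [plaq_expField_QsstarIter hd hk, (torusEdgeCellsIter P i k hd).Qstar_of_mem _ h, plaq_expField, curl_eq_mul_curl1,
    show (torusEdgeCellsIter P i k hd).m = 2 from rfl,
    show ((torusEdgeCellsIter P i k hd).L : ℝ) = (P.L : ℝ) ^ k by rw [iterE_L, Nat.cast_pow]]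
  congr 1
  calc e * η * (((P.L : ℝ) ^ k) ^ 2 * (((P.L : ℝ) ^ k)⁻¹ * curl1 B p'))
      = e * (η * (P.L : ℝ) ^ k) * (((P.L : ℝ) ^ k) * ((P.L : ℝ) ^ k)⁻¹) * curl1 B p' := by ring
    _ = e * curl1 B p' := by rw [hη, mul_inv_cancel₀ hL]; ring

/-- **(4.5.3) ⇒ the plaquette variables of `Q^{s*}_kv`**, second case: a plaquette of the η-lattice that is not an edge plaquette has
`(Q^{s*}_kv)(∂p) = 1` — either all its bonds lie strictly inside a k-block ((4.5.3): pull-back `1`), or it crosses one corridor through two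
parallel bonds carrying the same `v_c` with opposite orientations (standing range, `2 ≤ d`). [cite: BalabanImbrieJaffe1985, (4.5.3) p.312] -/
theorem plaq_QsstarU1_of_not_mem (hd : 2 ≤ P.d) {k : ℕ} (hk : i + k ≤ P.m + P.K) (a : ℝ) (B : PBond P (i + k) → ℝ) {p : Plaq P i}
    (h : ∀ p', p ∉ (torusEdgeCellsIter P i k hd).B p') :
    plaq (expField a ((torusBlockBondsIter P i k).Qsstar B)) p = 1 := by
  rw [plaq_expField_QsstarIter hd hk, (torusEdgeCellsIter P i k hd).Qstar_of_not_mem _ h, mul_zero, Circle.exp_zero]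

/-- The plaquette variables of `Q^{s*}_kv` in the printed exponential form: *"u_k(∂p) = exp[ie_kη²Q^{e*}_kf^{(k)} …]"* (p. 317) at `X = 0` —
`(Q^{s*}_kv)(∂p) = exp[ie_kη²(Q^{e*}_kf^{(k)})(p)]` with `f^{(k)} = (ie_k)^{−1} ln v(∂·)` ((4.2.4), branch (2.11)), for ANY Lie-algebra
representative `B` of `v = exp(ie_kB)` (the independence of the branch noted on p. 312); `e ≠ 0`, `ηL^k = 1` (standing range, `2 ≤ d`).
[cite: BalabanImbrieJaffe1985, (5.2.12) p.317] -/
theorem plaq_QsstarU1_eq_exp (hd : 2 ≤ P.d) {k : ℕ} (hk : i + k ≤ P.m + P.K) {e : ℝ} (he : e ≠ 0) (η : ℝ)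
    (hη : η * (P.L : ℝ) ^ k = 1) (B : PBond P (i + k) → ℝ) (p : Plaq P i) :
    plaq (expField (e * η) ((torusBlockBondsIter P i k).Qsstar B)) p =
      Circle.exp (e * η ^ 2 * (torusEdgeCellsIter P i k hd).Qstar (plaqField e (expField e B)) p) := by
  by_cases hp : ∃ p', p ∈ (torusEdgeCellsIter P i k hd).B p'
  · obtain ⟨p', h⟩ := hp
    rw [plaq_QsstarU1_of_mem hd hk e η hη B h, (torusEdgeCellsIter P i k hd).Qstar_of_mem _ h, ← circleExp_plaqField e he,
      show (torusEdgeCellsIter P i k hd).m = 2 from rfl,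
      show ((torusEdgeCellsIter P i k hd).L : ℝ) = (P.L : ℝ) ^ k by rw [iterE_L, Nat.cast_pow]]
    congr 1
    calc e * plaqField e (expField e B) p' = e * (η * (P.L : ℝ) ^ k) ^ 2 * plaqField e (expField e B) p' := by rw [hη]; ring
      _ = e * η ^ 2 * (((P.L : ℝ) ^ k) ^ 2 * plaqField e (expField e B) p') := by ring
  · push Not at hp
    rw [plaq_QsstarU1_of_not_mem hd hk _ B hp, (torusEdgeCellsIter P i k hd).Qstar_of_not_mem _ hp, mul_zero, Circle.exp_zero]

/-- The plaquette FIELD of `Q^{s*}_kv` (any coupling `a ≠ 0` for the logarithm): `(ia)^{−1} ln(Q^{s*}_kv)(∂p) = (ia)^{−1} ln v(∂p′)` for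
`p ∈ B^e_k(p′)` — EXACT, no smallness: both sides are the branch (2.11) applied to the same group element (`ηL^k = 1`; standing range,
`2 ≤ d`). [cite: BalabanImbrieJaffe1985, (6.4) p.318] -/
theorem plaqField_QsstarU1_of_mem (hd : 2 ≤ P.d) {k : ℕ} (hk : i + k ≤ P.m + P.K) (a e η : ℝ) (hη : η * (P.L : ℝ) ^ k = 1)
    (B : PBond P (i + k) → ℝ) {p : Plaq P i} {p' : Plaq P (i + k)} (h : p ∈ (torusEdgeCellsIter P i k hd).B p') :
    plaqField a (expField (e * η) ((torusBlockBondsIter P i k).Qsstar B)) p = plaqField a (expField e B) p' := by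
  unfold plaqField
  rw [plaq_QsstarU1_of_mem hd hk e η hη B h]

/-- … and `= 0` on every other plaquette (`ln 1 = 0`). [cite: BalabanImbrieJaffe1985, (6.4) p.318] -/
theorem plaqField_QsstarU1_of_not_mem (hd : 2 ≤ P.d) {k : ℕ} (hk : i + k ≤ P.m + P.K) (a b : ℝ) (B : PBond P (i + k) → ℝ)
    {p : Plaq P i} (h : ∀ p', p ∉ (torusEdgeCellsIter P i k hd).B p') :
    plaqField a (expField b ((torusBlockBondsIter P i k).Qsstar B)) p = 0 :=
  plaqField_eq_zero_of_plaq_eq_one a (plaq_QsstarU1_of_not_mem hd hk b B h)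

/-- The plaquette field of `Q^{s*}_kv` as an edge average: `(ia)^{−1} ln(Q^{s*}_kv)(∂·) = (a′/a)·L^{−2k}·Q^{e*}_k[(ia′)^{−1} ln v(∂·)]` for any
two couplings `a, a′ ≠ 0` (the factor `L^{2k}` of `Q^{e*}_k`, (2.22)/(2.24), undone; `ηL^k = 1`; standing range, `2 ≤ d`) — EXACT.
[cite: BalabanImbrieJaffe1985, (6.4) p.318] -/
theorem plaqField_QsstarU1 (hd : 2 ≤ P.d) {k : ℕ} (hk : i + k ≤ P.m + P.K) {a a' : ℝ} (ha : a ≠ 0) (ha' : a' ≠ 0) (e η : ℝ)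
    (hη : η * (P.L : ℝ) ^ k = 1) (B : PBond P (i + k) → ℝ) (p : Plaq P i) :
    plaqField a (expField (e * η) ((torusBlockBondsIter P i k).Qsstar B)) p =
      a' / a * (((P.L : ℝ) ^ k) ^ 2)⁻¹ * (torusEdgeCellsIter P i k hd).Qstar (plaqField a' (expField e B)) p := by
  have hL0 : (P.L : ℝ) ≠ 0 := Nat.cast_ne_zero.mpr P.L_pos.ne'
  have hL : (P.L : ℝ) ^ k ≠ 0 := pow_ne_zero _ hL0
  by_cases hp : ∃ p', p ∈ (torusEdgeCellsIter P i k hd).B p'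
  · obtain ⟨p', h⟩ := hp
    rw [plaqField_QsstarU1_of_mem hd hk a e η hη B h, (torusEdgeCellsIter P i k hd).Qstar_of_mem _ h,
      show (torusEdgeCellsIter P i k hd).m = 2 from rfl,
      show ((torusEdgeCellsIter P i k hd).L : ℝ) = (P.L : ℝ) ^ k by rw [iterE_L, Nat.cast_pow]]
    unfold plaqField
    rw [div_eq_iff ha]
    field_simp
  · push Not at hp
    rw [plaqField_QsstarU1_of_not_mem hd hk a _ B hp, (torusEdgeCellsIter P i k hd).Qstar_of_not_mem _ hp, mul_zero]

/-! ### One step (`k = 1`): the geometry `torusBlockBonds` / `torusEdgeCells` of Sects. 2–3 and 6 -/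

/-- kernel, one step: the plaquette variable of `exp(ia·Q^{s*}B)` is `exp(ia·(Q^{e*}∂_{L⁻¹}B)(p))` (`BIJ85CurlQsstar.curl_one_Qsstar`
exponentiated; standing range, `2 ≤ d`). [cite: BalabanImbrieJaffe1985, (6.2) p.318] -/
theorem plaq_expField_Qsstar1 (hj : j + 1 ≤ P.m + P.K) (hd : 2 ≤ P.d) (a : ℝ) (B : PBond P (j + 1) → ℝ) (p : Plaq P j) :
    plaq (expField a ((torusBlockBonds P j).Qsstar B)) p = Circle.exp (a * (torusEdgeCells P j hd).Qstar (curl ((P.L : ℝ))⁻¹ B) p) := by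
  rw [plaq_expField, ← curl_one_eq_curl1, curl_one_Qsstar hj hd B]

/-- **(Q^{s*}v)(∂p) = v(∂p′)** for `p ∈ B^e(p′)`, one step (Sect. 6: unit lattice `T^{(j)}` ⊃ L-lattice `T^{(j+1)}`, `(Q^{s*}v)_b = exp(ie_kη(Q^{s*}B)_b)`
with `ηL = 1`, `v = exp(ie_kB)`): the group-valued pull-back has the coarse plaquette variables on edge plaquettes (standing range, `2 ≤ d`).
[cite: BalabanImbrieJaffe1985, (6.4) p.318] -/
theorem plaq_Qsstar1U1_of_mem (hj : j + 1 ≤ P.m + P.K) (hd : 2 ≤ P.d) (e η : ℝ) (hη : η * (P.L : ℝ) = 1) (B : PBond P (j + 1) → ℝ)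
    {p : Plaq P j} {p' : Plaq P (j + 1)} (h : p ∈ (torusEdgeCells P j hd).B p') :
    plaq (expField (e * η) ((torusBlockBonds P j).Qsstar B)) p = plaq (expField e B) p' := by
  have hL : (P.L : ℝ) ≠ 0 := Nat.cast_ne_zero.mpr P.L_pos.ne'
  rw [plaq_expField_Qsstar1 hj hd, (torusEdgeCells P j hd).Qstar_of_mem _ h, plaq_expField, curl_eq_mul_curl1,
    show (torusEdgeCells P j hd).m = 2 from rfl, oneE_L]
  congr 1
  calc e * η * ((P.L : ℝ) ^ 2 * (((P.L : ℝ))⁻¹ * curl1 B p'))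
      = e * (η * (P.L : ℝ)) * ((P.L : ℝ) * ((P.L : ℝ))⁻¹) * curl1 B p' := by ring
    _ = e * curl1 B p' := by rw [hη, mul_inv_cancel₀ hL]; ring

/-- … and `(Q^{s*}v)(∂p) = 1` on every unit-lattice plaquette that is not an edge plaquette (standing range, `2 ≤ d`).
[cite: BalabanImbrieJaffe1985, (6.4) p.318] -/
theorem plaq_Qsstar1U1_of_not_mem (hj : j + 1 ≤ P.m + P.K) (hd : 2 ≤ P.d) (a : ℝ) (B : PBond P (j + 1) → ℝ) {p : Plaq P j}
    (h : ∀ p', p ∉ (torusEdgeCells P j hd).B p') :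
    plaq (expField a ((torusBlockBonds P j).Qsstar B)) p = 1 := by
  rw [plaq_expField_Qsstar1 hj hd, (torusEdgeCells P j hd).Qstar_of_not_mem _ h, mul_zero, Circle.exp_zero]

/-- one step, the printed exponential form: `(Q^{s*}v)(∂p) = exp[ie_kη²(Q^{e*}f)(p)]` with `f = (ie_k)^{−1} ln v(∂·)` on the L-lattice
`T^{(j+1)}`, `ηL = 1` (so `η² = L^{−2}`: the form *"(Q^{s*}v)(∂p) = e^{ie₀L^{−2}(Q^{e*}f)(p)}"* in which [BalabanImbrieJaffe1988] (3.25) uses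
this paper's (2.19)–(2.24)); `e ≠ 0` (standing range, `2 ≤ d`). [cite: BalabanImbrieJaffe1985, (6.4) p.318] -/
theorem plaq_Qsstar1U1_eq_exp (hj : j + 1 ≤ P.m + P.K) (hd : 2 ≤ P.d) {e : ℝ} (he : e ≠ 0) (η : ℝ) (hη : η * (P.L : ℝ) = 1)
    (B : PBond P (j + 1) → ℝ) (p : Plaq P j) :
    plaq (expField (e * η) ((torusBlockBonds P j).Qsstar B)) p =
      Circle.exp (e * η ^ 2 * (torusEdgeCells P j hd).Qstar (plaqField e (expField e B)) p) := by
  by_cases hp : ∃ p', p ∈ (torusEdgeCells P j hd).B p'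
  · obtain ⟨p', h⟩ := hp
    rw [plaq_Qsstar1U1_of_mem hj hd e η hη B h, (torusEdgeCells P j hd).Qstar_of_mem _ h, ← circleExp_plaqField e he,
      show (torusEdgeCells P j hd).m = 2 from rfl, oneE_L]
    congr 1
    calc e * plaqField e (expField e B) p' = e * (η * (P.L : ℝ)) ^ 2 * plaqField e (expField e B) p' := by rw [hη]; ring
      _ = e * η ^ 2 * ((P.L : ℝ) ^ 2 * plaqField e (expField e B) p') := by ring
  · push Not at hp
    rw [plaq_Qsstar1U1_of_not_mem hj hd _ B hp, (torusEdgeCells P j hd).Qstar_of_not_mem _ hp, mul_zero, Circle.exp_zero]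

/-! ## 3. Remark 2 p. 317: the plaquette variables of the background field `u_k` (4.5.4) -/

/-- kernel: the plaquette variable of the background field factors, `u_k(∂p) = (Q^{s*}_kv)(∂p) · exp[−ie_kη·X(∂p)]` (U(1) is abelian;
`X(∂p)` = the unit plaquette sum `curl1 X p`). [cite: BalabanImbrieJaffe1985, (4.5.4) p.313] -/
theorem plaq_background (k : ℕ) (e η : ℝ) (B : PBond P (i + k) → ℝ) (X : PBond P i → ℝ) (p : Plaq P i) :
    plaq (expField (e * η) (fun b => (torusBlockBondsIter P i k).Qsstar B b - X b)) p =
      plaq (expField (e * η) ((torusBlockBondsIter P i k).Qsstar B)) p * Circle.exp (-(e * η * curl1 X p)) := by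
  rw [expField_background_eq_translate62, plaq_translate62, plaq_expField (e * η) (fun b => -X b)]
  congr 2
  simp only [curl1]
  ring

/-- **Remark 2 p. 317 [PDF 19], the holonomy of (4.5.4)**, verbatim: *"This follows from the definition (4.5.4) of u_k, giving u_k(∂p) =
exp[ie_kη²Q^{e*}_kf^{(k)} − ie_kη²∂𝒟_k∂^*Q^{e*}_kf^{(k)}]."* — PROVED on the tori for `u_k = expField (e_kη) (Q^{s*}_kB − X)` (values
`BlockBonds.backgroundField e_k η B X`, `coe_expField_background`), `v = exp(ie_kB)`, `f^{(k)} = (ie_k)^{−1} ln v(∂·)` ((4.2.4)), `X` the supplied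
η-lattice bond field (= 𝒟_k∂^*Q^{e*}_kf^{(k)} in the paper) and `∂ = curl η⁻¹` the η-lattice curl: `u_k(∂p) = exp[ie_kη²((Q^{e*}_kf^{(k)})(p) −
(∂X)(p))]`; `e ≠ 0`, `ηL^k = 1` (standing range, `2 ≤ d`). [cite: BalabanImbrieJaffe1985, (5.2.12) p.317] -/
theorem plaq_background_eq_exp (hd : 2 ≤ P.d) {k : ℕ} (hk : i + k ≤ P.m + P.K) {e : ℝ} (he : e ≠ 0) (η : ℝ)
    (hη : η * (P.L : ℝ) ^ k = 1) (B : PBond P (i + k) → ℝ) (X : PBond P i → ℝ) (p : Plaq P i) :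
    plaq (expField (e * η) (fun b => (torusBlockBondsIter P i k).Qsstar B b - X b)) p =
      Circle.exp (e * η ^ 2 * ((torusEdgeCellsIter P i k hd).Qstar (plaqField e (expField e B)) p - curl η⁻¹ X p)) := by
  have hη0 : η ≠ 0 := by rintro rfl; simp at hη
  rw [plaq_background, plaq_QsstarU1_eq_exp hd hk he η hη, ← Circle.exp_add, curl_eq_mul_curl1]
  congr 1
  field_simp
  ring

/-- **(5.2.12)** p. 317 [PDF 19] in the torus model: the plaquette field `f_k(p) = (ie_kη²)^{−1} ln u_k(∂p)` of the background field (4.5.4) IS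
`(Q^{e*}_kf^{(k)})(p) − (∂X)(p)` — *"(ie_kη²)^{−1} ln u_k(∂p) = Q^{e*}_kf^{(k)} − ∂G_{k,Ax}∂^*Q^{e*}_kf^{(k)}, coinciding with (4.2.6)"* before
(5.2.10) is used (here `X` stands for 𝒟_k∂^*Q^{e*}_kf^{(k)}; replacing `∂𝒟_k∂^*` by `∂G_{k,Ax}∂^*` is the operator step `BIJ85Eq427Proof.eq5212`,
whose hypothesis `hhol` this identity instantiates) — valid whenever `e_kη²·[(Q^{e*}_kf^{(k)})(p) − (∂X)(p)]` lies in `(−π, π)`, the range of the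
branch (2.11); `e ≠ 0`, `ηL^k = 1` (standing range, `2 ≤ d`). [cite: BalabanImbrieJaffe1985, (5.2.12) p.317] -/
theorem plaqField_background (hd : 2 ≤ P.d) {k : ℕ} (hk : i + k ≤ P.m + P.K) {e : ℝ} (he : e ≠ 0) (η : ℝ)
    (hη : η * (P.L : ℝ) ^ k = 1) (B : PBond P (i + k) → ℝ) (X : PBond P i → ℝ) (p : Plaq P i)
    (hsmall : |e * η ^ 2 * ((torusEdgeCellsIter P i k hd).Qstar (plaqField e (expField e B)) p - curl η⁻¹ X p)| < π) :
    plaqField (e * η ^ 2) (expField (e * η) (fun b => (torusBlockBondsIter P i k).Qsstar B b - X b)) p =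
      (torusEdgeCellsIter P i k hd).Qstar (plaqField e (expField e B)) p - curl η⁻¹ X p := by
  have hη0 : η ≠ 0 := by rintro rfl; simp at hη
  exact plaqField_of_plaq_eq_exp (mul_ne_zero he (pow_ne_zero 2 hη0)) (plaq_background_eq_exp hd hk he η hη B X p) hsmall

/-! ## 4. (6.4) p. 318: the second summand `(ie_k)^{−1} ln(Q^{s*}v)(∂p) = L^{−d/2}(Q^{e*}f^{(k+1)})(p)` -/

/-- kernel: the running coupling (4.2.4)/(1.1) `e(a) = e·a^{(4−d)/2}` (`BIJ85Sect1Model.eEps`) one scale up: `e(L·a) = L^{(4−d)/2}·e(a)`, i.e.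
`e_{k+1} = L^{(4−d)/2}e_k` (`0 ≤ L`, `0 ≤ a`). [cite: BalabanImbrieJaffe1985, (4.2.4) p.310] -/
theorem eEps_mul (e L a : ℝ) (hL : 0 ≤ L) (ha : 0 ≤ a) (d : ℕ) :
    eEps e (L * a) d = L ^ ((4 - (d : ℝ)) / 2) * eEps e a d := by
  unfold eEps
  rw [Real.mul_rpow hL ha]
  ring

/-- one step, general couplings: `(ia)^{−1} ln(Q^{s*}v)(∂·) = (a′/a)·L^{−2}·Q^{e*}[(ia′)^{−1} ln v(∂·)]` EXACTLY, for any `a, a′ ≠ 0` (`(Q^{s*}v)_b =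
exp(ie_kη(Q^{s*}B)_b)`, `ηL = 1`, `v = exp(ie_kB)`; standing range, `2 ≤ d`). [cite: BalabanImbrieJaffe1985, (6.4) p.318] -/
theorem plaqField_Qsstar1U1 (hj : j + 1 ≤ P.m + P.K) (hd : 2 ≤ P.d) {a a' : ℝ} (ha : a ≠ 0) (ha' : a' ≠ 0) (e η : ℝ)
    (hη : η * (P.L : ℝ) = 1) (B : PBond P (j + 1) → ℝ) (p : Plaq P j) :
    plaqField a (expField (e * η) ((torusBlockBonds P j).Qsstar B)) p =
      a' / a * ((P.L : ℝ) ^ 2)⁻¹ * (torusEdgeCells P j hd).Qstar (plaqField a' (expField e B)) p := by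
  have hL : (P.L : ℝ) ≠ 0 := Nat.cast_ne_zero.mpr P.L_pos.ne'
  by_cases hp : ∃ p', p ∈ (torusEdgeCells P j hd).B p'
  · obtain ⟨p', h⟩ := hp
    rw [(torusEdgeCells P j hd).Qstar_of_mem _ h, show (torusEdgeCells P j hd).m = 2 from rfl, oneE_L]
    unfold plaqField
    rw [plaq_Qsstar1U1_of_mem hj hd e η hη B h, div_eq_iff ha]
    field_simp
  · push Not at hp
    rw [(torusEdgeCells P j hd).Qstar_of_not_mem _ hp, mul_zero]
    exact plaqField_eq_zero_of_plaq_eq_one a (plaq_Qsstar1U1_of_not_mem hj hd _ B hp)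

/-- **(6.4) p. 318 [PDF 20], the second summand**, verbatim: *"(ie_k)^{−1} ln(Q^{s*}v)(∂p) = … L^{−d/2}(Q^{e*}f^{(k+1)})(p), (6.4) … The new field
f^{(k+1)} is an L-lattice field, but Q^{e*}_k maps it back (to edge plaquettes) in the unit lattice."* — PROVED EXACTLY on the tori (this
summand needs no smallness: `(Q^{s*}v)(∂p)` is `v(∂p′)` or `1`), with `(Q^{s*}v)_b = exp(ie_kη(Q^{s*}B)_b)`, `ηL = 1`, `v = exp(ie_kB)` on the
L-lattice `T^{(j+1)}`, `f^{(k+1)} = (ie_{k+1})^{−1} ln v(∂·)` with the next coupling `e_{k+1} = L^{(4−d)/2}e_k` of (4.2.4) (`eEps_mul`), whence the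
printed factor `L^{−d/2} = (e_{k+1}/e_k)·L^{−2}`; rescaling to the unit lattice is the identity on these types (`Setup` F7); `e_k ≠ 0` (standing
range, `2 ≤ d`). [cite: BalabanImbrieJaffe1985, (6.4) p.318] -/
theorem eq64_second_summand (hj : j + 1 ≤ P.m + P.K) (hd : 2 ≤ P.d) {e : ℝ} (he : e ≠ 0) (η : ℝ) (hη : η * (P.L : ℝ) = 1)
    (B : PBond P (j + 1) → ℝ) (p : Plaq P j) :
    plaqField e (expField (e * η) ((torusBlockBonds P j).Qsstar B)) p =
      (P.L : ℝ) ^ (-(P.d : ℝ) / 2) *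
        (torusEdgeCells P j hd).Qstar (plaqField ((P.L : ℝ) ^ ((4 - (P.d : ℝ)) / 2) * e) (expField e B)) p := by
  have hL : (0 : ℝ) < P.L := Nat.cast_pos.mpr P.L_pos
  have hpow : (P.L : ℝ) ^ ((4 - (P.d : ℝ)) / 2) ≠ 0 := (Real.rpow_pos_of_pos hL _).ne'
  rw [plaqField_Qsstar1U1 hj hd he (mul_ne_zero hpow he) e η hη B p]
  congr 1
  rw [mul_div_assoc, div_self he, mul_one, show ((4 - (P.d : ℝ)) / 2) = -(P.d : ℝ) / 2 + 2 by ring, Real.rpow_add hL,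
    Real.rpow_two, mul_assoc, mul_inv_cancel₀ (pow_ne_zero _ hL.ne'), mul_one]

/-- **(6.4) p. 318 [PDF 20]**, verbatim: *"f^{(k)}(p) = (ie_k)^{−1} ln u′(∂p) + (ie_k)^{−1} ln(Q^{s*}v)(∂p) = (∂B′)(p) + L^{−d/2}(Q^{e*}f^{(k+1)})(p), (6.4)
which is valid as long as u′(p) and (Q^{s*}_kv)(p) are close to 1."* — PROVED on the tori for `u = u′·Q^{s*}v` ((6.2), `translate62`), `u′ =
exp(ie_kB′)`, `f^{(k)} = (ie_k)^{−1} ln u(∂·)` ((6.3)), `f^{(k+1)} = (ie_{k+1})^{−1} ln v(∂·)`, `e_{k+1} = L^{(4−d)/2}e_k`, in the small-field region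
made explicit as: `|arg u′(∂p)| < π/2`, `|arg (Q^{s*}v)(∂p)| < π/2` (additivity of the branch, `BIJ85SmallFieldSplit64.eq64_smallField`) and
`|e_k(∂B′)(p)| < π` (no winding); `ηL = 1`, `e_k ≠ 0` (standing range, `2 ≤ d`). [cite: BalabanImbrieJaffe1985, (6.4) p.318] -/
theorem eq64 (hj : j + 1 ≤ P.m + P.K) (hd : 2 ≤ P.d) {e : ℝ} (he : e ≠ 0) (η : ℝ) (hη : η * (P.L : ℝ) = 1)
    (B' : PBond P j → ℝ) (B : PBond P (j + 1) → ℝ) (p : Plaq P j)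
    (hu : |Complex.arg ((plaq (expField e B') p : Circle) : ℂ)| < π / 2)
    (hw : |Complex.arg ((plaq (expField (e * η) ((torusBlockBonds P j).Qsstar B)) p : Circle) : ℂ)| < π / 2)
    (hsmall : |e * curl1 B' p| < π) :
    plaqField e (translate62 (expField e B') (expField (e * η) ((torusBlockBonds P j).Qsstar B))) p =
      curl1 B' p + (P.L : ℝ) ^ (-(P.d : ℝ) / 2) *
        (torusEdgeCells P j hd).Qstar (plaqField ((P.L : ℝ) ^ ((4 - (P.d : ℝ)) / 2) * e) (expField e B)) p := by
  rw [eq64_smallField e _ _ p hu hw, plaqField_expField e he B' p hsmall, eq64_second_summand hj hd he η hη B p]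

end Literature.MathematicalPhysics.QuantumFieldTheory.BalabanImbrieJaffe1984to88.BIJ85Eq454Holonomy
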